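import Summits.NavierStokesRegularity.NavierStokesRegularity.Theorems.EpisodeBaseT.Negative.TameCarrierOfRecordHasSwirl
import HarnessLib

/-!
# The blob of record is sterile; the carrier's swirl is exactly the pusher's (Negative lane, `EpisodeBaseT`, line «doormirror» stub D2)

Completes `TameCarrierOfRecordHasSwirl` (p559308) for the crux chain of `EpisodeBaseT` (item 20303, line
«doormirror», stub D2 `SterileMechanismDoorT`): the BLOB half of the strict-slot carrier of record,
`tinyBlob a y = F(‖y‖²/a²) e₃ − (y₂ G(‖y‖²/a²)/a²) y` and `tinyProfileAt R a = Y₀(R) • tinyBlob a`, IS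
axisymmetric AND swirl-free (`isAxisymmetric_tinyBlob`, `hasNoSwirl_tinyBlob`, `…_tinyProfileAt`) — a
genuine sterile level-0 object already in the tree. Since swirl is additive, the swirl of the carrier
`tameCarrierAt R a λ = tinyProfileAt R a + faintPusher (λ Y₀(R)/Y₀(wide))` is EXACTLY the faint pusher's
(`swirl_tameCarrierAt`), whence the clean dichotomy

`hasNoSwirl_tameCarrierAt_iff : HasNoSwirl (tameCarrierAt R a λ) ↔ λ = 0`

(no hypothesis on `a`): the carrier of record is sterile iff the pusher is switched off — and the slot
lemma of record `levelZeroDataAt_tameCarrierAt` needs `0 < λ` (the pusher supplies the strict anchor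
face). So a sterile strict-slot carrier for D2 = the blob of record + a NEW swirl-free device for the
anchor face `0 < ⟪U x, accel 1 U x⟫` at the speed argmax (or a proof that the blob alone passes it, which
the record's `0 < λ` requirement suggests it does not).

WHAT THIS IS NOT: not Navier–Stokes evidence; not a refutation of D2; explicit algebra on tree objects;
sorry-free, std axioms; no item moves.
-/

noncomputable section

open Literature.Analysis.FluidPDE
open Summit.NavierStokesRegularity.FluidComputer.PalasekTowerClayBridge
open Summit.NavierStokesRegularity.FluidComputer.PalasekTowerClayBridge.TinyBlob
open Summit.NavierStokesRegularity.FluidComputer.PalasekTowerClayBridge.Germ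

namespace Summit.NavierStokesRegularity.EpisodeBaseTTameCarrierOfRecordHasSwirl

/-! ## The blob of record is axisymmetric and swirl-free -/

/-- **The tiny blob is swirl-free**: `Γ[B_a] ≡ 0` (its components are along `e₃` and along `y`). [folklore] -/
theorem hasNoSwirl_tinyBlob (a : ℝ) : HasNoSwirl (tinyBlob a) := fun x => by
  simp [swirl, tinyBlob, e₃]
  ring

/-- **The tiny blob is axisymmetric** about `e₃` (coefficients depend on `‖y‖` and `y₂` only). [folklore] -/
theorem isAxisymmetric_tinyBlob (a : ℝ) : IsAxisymmetric (tinyBlob a) := fun θ x => by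
  ext i
  fin_cases i <;> simp [tinyBlob, e₃, norm_rotZ] <;> ring

/-- The blob profile at the rates `R` is swirl-free. [folklore] -/
theorem hasNoSwirl_tinyProfileAt (R : TowerRates) (a : ℝ) : HasNoSwirl (tinyProfileAt R a) := fun x => by
  have h := hasNoSwirl_tinyBlob a x
  simp only [swirl, tinyProfileAt, PiLp.smul_apply, smul_eq_mul] at h ⊢
  linear_combination (R.Y 0) * h

/-- The blob profile at the rates `R` is axisymmetric. [folklore] -/
theorem isAxisymmetric_tinyProfileAt (R : TowerRates) (a : ℝ) : IsAxisymmetric (tinyProfileAt R a) :=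
  fun θ x => by
  have h := isAxisymmetric_tinyBlob a θ x
  ext i
  fin_cases i <;> simp [tinyProfileAt, h] <;> ring

/-! ## The carrier's swirl is the pusher's -/

/-- Swirl is additive. [folklore] -/
theorem swirl_add (U V : EuclideanSpace ℝ (Fin 3) → EuclideanSpace ℝ (Fin 3)) (x : EuclideanSpace ℝ (Fin 3)) :
    swirl (U + V) x = swirl U x + swirl V x := by
  simp only [swirl, Pi.add_apply, PiLp.add_apply]
  ring

variable {R : TowerRates} {a lam : ℝ}

/-- **The swirl of the carrier of record is exactly the faint pusher's**, at every point:
`Γ[tameCarrierAt R a λ](x) = λ (Y₀(R)/Y₀(wide)) · Γ[farPusher](x)`. [folklore] -/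
theorem swirl_tameCarrierAt (x : EuclideanSpace ℝ (Fin 3)) :
    swirl (tameCarrierAt R a lam) x = lam * (R.Y 0 / TowerRates.wide.Y 0) * swirl farPusher x := by
  rw [show tameCarrierAt R a lam = tinyProfileAt R a + faintPusher (lam * (R.Y 0 / TowerRates.wide.Y 0))
    from rfl, swirl_add, hasNoSwirl_tinyProfileAt R a x, zero_add, swirl_faintPusher]

/-- **DICHOTOMY: the strict-slot carrier of record is swirl-free iff the pusher is off** (`λ = 0`; no
hypothesis on the blob scale `a`). The slot lemma of record `levelZeroDataAt_tameCarrierAt` requires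
`0 < λ`. [folklore] -/
theorem hasNoSwirl_tameCarrierAt_iff : HasNoSwirl (tameCarrierAt R a lam) ↔ lam = 0 := by
  refine ⟨fun h => ?_, fun h x => by rw [swirl_tameCarrierAt, h, zero_mul, zero_mul]⟩
  have h0 := h strictPt
  rw [swirl_tameCarrierAt, swirl_farPusher_strictPt] at h0
  have hY := Host.wide_Y_zero_pos
  have hq : 0 < R.Y 0 / TowerRates.wide.Y 0 := div_pos (R.Y_pos 0) hY
  rcases mul_eq_zero.1 h0 with h1 | h1
  · rcases mul_eq_zero.1 h1 with h2 | h2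
    · exact h2
    · exact absurd h2 hq.ne'
  · nlinarith

/-- With the pusher off the carrier is the sterile blob: axisymmetric as well. [folklore] -/
theorem isAxisymmetric_tameCarrierAt_zero : IsAxisymmetric (tameCarrierAt R a 0) := by
  have h : tameCarrierAt R a 0 = tinyProfileAt R a := by
    funext x
    show tinyProfileAt R a x + faintPusher (0 * (R.Y 0 / TowerRates.wide.Y 0)) x = _
    rw [zero_mul, faintPusher_apply, zero_smul, add_zero]
  rw [h]
  exact isAxisymmetric_tinyProfileAt R a

end Summit.NavierStokesRegularity.EpisodeBaseTTameCarrierOfRecordHasSwirl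

end
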